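import Summits.Ventures.PercRepro.S1CFGDepFourArith

/-!
# PercRepro — THE ARITHMETIC OF THE SHARP DEPENDENT-`4`-SET CAP (p1, gen 40)

The cap of S1CFGDepFourSharp is `D₄ ≤ B(ν, n) := C(ν + 1, 4) + (n − ν − 1)·C(ν + 1, 3) + C(ν + 1, 2)` — S1CFGDepFour's cap
without the slack `(n − 3)`, sharp at `n = ν + 3`. The induction from `w` to `w + 1` needs (the slack-free versions of
S1CFGDepFourArith):
* `sharp_small` — `C(n, 4) ≤ B(ν, n)` for `n ≤ ν + 3`;
* `sharp_caseB` — `n·B(w, n − 1) ≤ (n − 4)·B(w + 1, n)` for `w ≥ 2`, `n ≥ w + 5`;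
* `sharp_caseA` — from `D ≤ D' + z·c₃' + extra`, `D' ≤ B(w, m)`, `c₃' ≤ C(w + 1, 3) + 1`, `m + z = n`, `m ≥ w + 3` and
  `extra + z ≤ (n − w − 2)·C(w + 1, 2) + (w + 1)`: `D ≤ B(w + 1, n)`;
* `sharp_caseA_crude` — the degenerate `m = w + 2`: from `D' ≤ C(w + 2, 4)`, `c₃' ≤ C(w + 2, 3)`, `extra ≤ C(w + 2, 2)`;
* `sharp_extra_two_le`, `sharp_extra_three_le` — the `extra` bounds with the `z` absorbed;
* `sharp_base_large` — the base `ν = 2`, `n ≥ 6`, `c₃ ≤ 1`: `(n − 3)·c₃ + n/(n − 4) ≤ n`.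
Nothing about any cell is claimed. Axioms: standard.
-/

namespace PercRepro

namespace S1CFG

/-- **THE SMALL CASE, SHARP**: `C(n, 4) ≤ B(ν, n)` for `n ≤ ν + 3`. -/
theorem sharp_small {ν n : ℕ} (hn : n ≤ ν + 3) :
    n.choose 4 ≤ (ν + 1).choose 4 + (n - ν - 1) * (ν + 1).choose 3 + (ν + 1).choose 2 := by
  obtain ⟨h1, h2, h3⟩ := choose_pascal ν
  rcases Nat.lt_or_ge n (ν + 2) with hlt | hge
  · have := Nat.choose_le_choose 4 (show n ≤ ν + 1 by omega)
    omega
  rcases Nat.lt_or_ge n (ν + 3) with hlt | hge'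
  · have hn' : n = ν + 2 := by omega
    subst hn'
    have : ν + 2 - ν - 1 = 1 := by omega
    rw [this]
    omega
  · have hn' : n = ν + 3 := by omega
    subst hn'
    have : ν + 3 - ν - 1 = 2 := by omega
    rw [this]
    have e1 : (ν + 3).choose 4 = (ν + 2).choose 3 + (ν + 2).choose 4 := Nat.choose_succ_succ' (ν + 2) 3
    omega

/-- **THE AVERAGING STEP, SHARP** (`w ≥ 2`, `n ≥ w + 5`): `n·B(w, n − 1) ≤ (n − 4)·B(w + 1, n)`. -/
theorem sharp_caseB {w n : ℕ} (hw : 2 ≤ w) (hn : w + 5 ≤ n) :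
    n * ((w + 1).choose 4 + (n - 1 - w - 1) * (w + 1).choose 3 + (w + 1).choose 2) ≤
      (n - 4) * ((w + 2).choose 4 + (n - (w + 1) - 1) * (w + 2).choose 3 + (w + 2).choose 2) := by
  obtain ⟨t, rfl⟩ : ∃ t, w = t + 2 := ⟨w - 2, by omega⟩
  obtain ⟨s, rfl⟩ : ∃ s, n = t + s + 7 := ⟨n - t - 7, by omega⟩
  obtain ⟨h4, h3, h2⟩ := choose_relations t
  obtain ⟨p4, p3, p2⟩ := choose_pascal (t + 2)
  have e1 : t + s + 7 - 1 - (t + 2) - 1 = s + 3 := by omega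
  have e3 : t + s + 7 - 4 = t + s + 3 := by omega
  have e4 : t + s + 7 - (t + 2 + 1) - 1 = s + 3 := by omega
  rw [e1, e3, e4, show t + 2 + 1 = t + 3 by rfl, show t + 2 + 2 = t + 4 by rfl] at *
  rw [p4, p3, p2]
  set a := (t + 3).choose 4
  set b := (t + 3).choose 3
  set c := (t + 3).choose 2
  zify at h4 h3 h2 ⊢
  have key : ((t + s + 3 : ℕ) : ℤ) * ((a + b) + (s + 3) * (b + c) + (c + (t + 3))) -
      ((t + s + 7 : ℕ) : ℤ) * (a + (s + 3) * b + c) =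
      c * (s * s + 5 * s + 2) + (t + 3) * (t + s + 3) := by
    push_cast
    linear_combination (-1 : ℤ) * h4 - ((s : ℤ) + 3) * h3
  have hnn : (0 : ℤ) ≤ c * (s * s + 5 * s + 2) + (t + 3) * (t + s + 3) := by positivity
  push_cast at key ⊢
  linarith

/-- **THE SERIES-CLASS STEP, SHARP** (main sub-case `m ≥ w + 3`). -/
theorem sharp_caseA {w n m z D D' c₃' extra : ℕ} (hmz : m + z = n) (hm : w + 3 ≤ m)
    (hD : D ≤ D' + z * c₃' + extra)
    (hD' : D' ≤ (w + 1).choose 4 + (m - w - 1) * (w + 1).choose 3 + (w + 1).choose 2)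
    (hc : c₃' ≤ (w + 1).choose 3 + 1)
    (hextra : extra + z ≤ (n - w - 2) * (w + 1).choose 2 + (w + 1)) :
    D ≤ (w + 2).choose 4 + (n - (w + 1) - 1) * (w + 2).choose 3 + (w + 2).choose 2 := by
  obtain ⟨p4, p3, p2⟩ := choose_pascal w
  rw [p4, p3, p2]
  obtain ⟨k, rfl⟩ : ∃ k, m = w + 3 + k := ⟨m - w - 3, by omega⟩
  subst hmz
  have e1 : w + 3 + k - w - 1 = k + 2 := by omega
  have e3 : w + 3 + k + z - (w + 1) - 1 = k + z + 1 := by omega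
  have e4 : w + 3 + k + z - w - 2 = k + z + 1 := by omega
  rw [e1] at hD'
  rw [e4] at hextra
  rw [e3]
  set a := (w + 1).choose 4
  set b := (w + 1).choose 3
  set c := (w + 1).choose 2
  have h1 : z * c₃' ≤ z * (b + 1) := Nat.mul_le_mul_left z hc
  have h2 : D' + z * c₃' + extra ≤ (a + (k + 2) * b + c) + z * (b + 1) + extra :=
    Nat.add_le_add (Nat.add_le_add hD' h1) le_rfl
  have h3 : (a + (k + 2) * b + c) + z * (b + 1) + extra ≤
      a + b + (k + z + 1) * (b + c) + (c + (w + 1)) := by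
    have : extra + z ≤ (k + z + 1) * c + (w + 1) := hextra
    nlinarith [this]
  exact hD.trans (h2.trans h3)

/-- **THE SERIES-CLASS STEP, SHARP** (degenerate sub-case `m = w + 2`): from `D' ≤ C(w + 2, 4)`, `c₃' ≤ C(w + 2, 3)`,
`extra ≤ C(w + 2, 2)` and `z = n − w − 2`. -/
theorem sharp_caseA_crude {w n m z D D' c₃' extra : ℕ} (hmz : m + z = n) (hm : m = w + 2)
    (hD : D ≤ D' + z * c₃' + extra) (hD' : D' ≤ (w + 2).choose 4) (hc : c₃' ≤ (w + 2).choose 3)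
    (hextra : extra ≤ (w + 2).choose 2) :
    D ≤ (w + 2).choose 4 + (n - (w + 1) - 1) * (w + 2).choose 3 + (w + 2).choose 2 := by
  subst hm
  subst hmz
  have e2 : w + 2 + z - (w + 1) - 1 = z := by omega
  rw [e2]
  have h1 : z * c₃' ≤ z * (w + 2).choose 3 := Nat.mul_le_mul_left z hc
  omega

/-- The `|Z| = 2` bound, sharp: `(n − 3) + q + 2 ≤ (n − w − 2)·C(w + 1, 2) + (w + 1)` when `2q ≤ (n − 2)·w`, `w ≥ 2`,
`n ≥ w + 5`. -/
theorem sharp_extra_two_le {w n q : ℕ} (hw : 2 ≤ w) (hn : w + 5 ≤ n) (hq : 2 * q ≤ (n - 2) * w) :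
    (n - 3) + q + 2 ≤ (n - w - 2) * (w + 1).choose 2 + (w + 1) := by
  obtain ⟨t, rfl⟩ : ∃ t, w = t + 2 := ⟨w - 2, by omega⟩
  obtain ⟨s, rfl⟩ : ∃ s, n = t + s + 7 := ⟨n - t - 7, by omega⟩
  have h2 : (t + 3).choose 2 * 2 = (t + 3) * (t + 2) := (choose_relations t).2.2
  have e1 : t + s + 7 - 3 = t + s + 4 := by omega
  have e2 : t + s + 7 - (t + 2) - 2 = s + 3 := by omega
  have e3 : t + s + 7 - 2 = t + s + 5 := by omega
  rw [e1, e2, show t + 2 + 1 = t + 3 by rfl]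
  rw [e3] at hq
  set c := (t + 3).choose 2
  have h2' : (s + 3) * (c * 2) = (s + 3) * ((t + 3) * (t + 2)) := by rw [h2]
  nlinarith [hq, h2', Nat.zero_le (s * t * t), Nat.zero_le (s * t), Nat.zero_le (t * t), Nat.zero_le s,
    Nat.zero_le t]

/-- The `|Z| = 3` bound, sharp: `(n − 3) + 3 ≤ (n − w − 2)·C(w + 1, 2) + (w + 1)` for `w ≥ 2`, `n ≥ w + 5`. -/
theorem sharp_extra_three_le {w n : ℕ} (hw : 2 ≤ w) (hn : w + 5 ≤ n) :
    (n - 3) + 3 ≤ (n - w - 2) * (w + 1).choose 2 + (w + 1) := by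
  have hc : 3 ≤ (w + 1).choose 2 := by
    have := Nat.choose_le_choose 2 (show 3 ≤ w + 1 by omega)
    simpa using this
  have : (n - w - 2) * 3 ≤ (n - w - 2) * (w + 1).choose 2 := Nat.mul_le_mul_left _ hc
  omega

/-- **THE BASE `ν = 2`, `n ≥ 6`, SHARP**: with `c₃ ≤ 1`, `D₄ ≤ (n − 3)·c₃ + c₄ ≤ (n − 3) + n/(n − 4) ≤ n = B(2, n)`. -/
theorem sharp_base_large {n D c₃ c₄ : ℕ} (hn : 6 ≤ n) (hD : D ≤ (n - 3) * c₃ + c₄) (hc₃ : c₃ ≤ 1)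
    (hc₄ : c₄ ≤ n * (2 + 2).choose 4 / (n - 4)) :
    D ≤ (2 + 1).choose 4 + (n - 2 - 1) * (2 + 1).choose 3 + (2 + 1).choose 2 := by
  have h4 : (2 + 2).choose 4 = 1 := by decide
  rw [h4, mul_one] at hc₄
  have hdiv : n / (n - 4) ≤ 3 := by
    rw [Nat.div_le_iff_le_mul_add_pred (by omega)]
    omega
  have : (n - 3) * c₃ ≤ (n - 3) * 1 := Nat.mul_le_mul_left _ hc₃
  simp only [show (2 + 1).choose 4 = 0 by decide, show (2 + 1).choose 3 = 1 by decide,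
    show (2 + 1).choose 2 = 3 by decide]
  omega

/-- `B(2, n) = n` (in the spelled-out form). -/
theorem sharp_base_eq (n : ℕ) (hn : 3 ≤ n) :
    (2 + 1).choose 4 + (n - 2 - 1) * (2 + 1).choose 3 + (2 + 1).choose 2 = n := by
  simp only [show (2 + 1).choose 4 = 0 by decide, show (2 + 1).choose 3 = 1 by decide,
    show (2 + 1).choose 2 = 3 by decide]
  omega

end S1CFG

end PercRepro
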